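import Summits.RiemannHypothesis.RiemannHypothesis.Theorems.UniversalFactorLaplaceLoopholeInterlacing
import Summits.RiemannHypothesis.RiemannHypothesis.Theorems.UniversalFactorLaguerreLift
import Summits.RiemannHypothesis.RiemannHypothesis.Theorems.UniversalFactorLaplaceLoopholeSignCriterion

/-!
# Crux-triage r1-1, evidence for card `pencil-bracket-count` (crux stmt-RiemannHypothesis-2577):
# the TOUCHING LEMMA behind its first lemma `ZeroFreeBracket`, contour-free

Along the Laguerre pencil `G_s = (1−s)F_a + sH_0 = F_a − F_a''/b²` (`s = a²/b²`) a first parameter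
`s*` at which `G_{s*}` touches zero on a bracket `[c,d]` produces a real point `x*` with
`G(x*) = G'(x*) = 0`, i.e. `F'' (x*) = b²F(x*)` and `F'''(x*) = b²F'(x*)`, while `F(x*) ≠ 0`.
`touching_false` shows this is impossible under `X(a)` WITHOUT any argument principle / Hurwitz:
only Laguerre's step (`laguerre_step`), the quantitative `(f'/f)' ≤ −1/|x−a₀|²`
(`re_deriv_logDeriv_le`), the zero-free structure lemma and evenness of `F_a` are used — all in tree.
-/

noncomputable section

open Complex Set
open Literature.NumberTheory.LFunctions Literature.Analysis.Complex
open Summit.RiemannHypothesis.RiemannHypothesis.Theses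
open Summit.RiemannHypothesis.RiemannHypothesis.Theorems

namespace TriageTouching

/-- **Lemma A.** A real entire function of order `< 2` with only real zeros and at least one zero
cannot satisfy `f'(x) = c f(x)`, `f''(x) = c² f(x)` at a real point with `f(x) ≠ 0`
(there `(f'/f)'(x) = 0`, against `(f'/f)' ≤ −1/|x − a₀|² < 0`). -/
theorem false_of_logDeriv_critical {f : ℂ → ℂ} (hf : Differentiable ℂ f) {ρ C : ℝ}
    (hρ0 : 0 ≤ ρ) (hρ : ρ < 2) (hgr : ∀ z, ‖f z‖ ≤ C * Real.exp (‖z‖ ^ ρ))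
    (hreal : ∀ x : ℝ, (f x).im = 0) (hzero : ∀ z, f z = 0 → z.im = 0) {a₀ : ℂ} (ha₀ : f a₀ = 0)
    {x : ℝ} (hx : f x ≠ 0) (c : ℂ) (h1 : deriv f x = c * f x)
    (h2 : deriv (deriv f) x = c ^ 2 * f x) : False := by
  have key := UniversalFactor.re_deriv_logDeriv_le hf hρ0 hρ hgr hreal hzero ha₀ hx
  have hd : deriv (fun z => deriv f z / f z) x = 0 := by
    have e : deriv (fun z => deriv f z / f z) x =
        (deriv (deriv f) x * f x - deriv f x * deriv f x) / f x ^ 2 :=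
      (((hf.deriv (x : ℂ)).hasDerivAt).div ((hf (x : ℂ)).hasDerivAt) hx).deriv
    rw [e, h1, h2]
    have : c ^ 2 * f x * f x - c * f x * (c * f x) = 0 := by ring
    rw [this, zero_div]
  rw [hd, Complex.zero_re] at key
  have hxa : (x : ℂ) - a₀ ≠ 0 := by
    intro h; rw [sub_eq_zero] at h; rw [h] at hx; exact hx ha₀
  have hpos : 0 < 1 / ‖(x : ℂ) - a₀‖ ^ 2 := by positivity
  linarith

/-- **Lemma B.** A zero-free real entire function of order `< 2` has constant logarithmic
derivative. -/
theorem logDeriv_eq_of_forall_ne_zero {g : ℂ → ℂ} (hg : Differentiable ℂ g) {ρ C : ℝ}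
    (hρ0 : 0 ≤ ρ) (hρ : ρ < 2) (hgr : ∀ z, ‖g z‖ ≤ C * Real.exp (‖z‖ ^ ρ))
    (hreal : ∀ x : ℝ, (g x).im = 0) (hne : ∀ z, g z ≠ 0) (z w : ℂ) :
    deriv g z / g z = deriv g w / g w := by
  have hd : Differentiable ℂ (fun z => deriv g z / g z) := fun z => (hg.deriv z).div (hg z) (hne z)
  have him : ∀ z, (deriv g z / g z).im = 0 := fun z =>
    im_logDeriv_eq_zero_of_forall_ne_zero hg hρ0 hρ hgr hreal hne z
  exact UniversalFactor.apply_eq_apply_of_im_eq_zero hd him z w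

/-- **Touching lemma.** Under `X(a)` (and given that `F_a` has a zero at all), no real point `x`
with `F_a(x) ≠ 0` can have `F_a''(x) = b²F_a(x)` and `F_a'''(x) = b²F_a'(x)` (`b ≠ 0` real), i.e.
`G = F_a − F_a''/b²` cannot have a multiple zero where `F_a ≠ 0`. -/
theorem touching_false {a b x : ℝ}
    (hX : HasOnlyRealZeros (deBruijnHDiv fun u : ℝ => 1 + u ^ 2 / a ^ 2))
    (hz : ∃ z₀, deBruijnHDiv (fun u : ℝ => 1 + u ^ 2 / a ^ 2) z₀ = 0)
    (hFx : deBruijnHDiv (fun u : ℝ => 1 + u ^ 2 / a ^ 2) x ≠ 0)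
    (h2 : deriv (deriv (deBruijnHDiv fun u : ℝ => 1 + u ^ 2 / a ^ 2)) x =
      (b : ℂ) ^ 2 * deBruijnHDiv (fun u : ℝ => 1 + u ^ 2 / a ^ 2) x)
    (h3 : deriv (deriv (deriv (deBruijnHDiv fun u : ℝ => 1 + u ^ 2 / a ^ 2))) x =
      (b : ℂ) ^ 2 * deriv (deBruijnHDiv fun u : ℝ => 1 + u ^ 2 / a ^ 2) x) : False := by
  set F : ℂ → ℂ := deBruijnHDiv fun u : ℝ => 1 + u ^ 2 / a ^ 2 with hFdef
  obtain ⟨a₀, ha₀⟩ := hz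
  have hzero : ∀ z, F z = 0 → z.im = 0 := hX
  have hFd : Differentiable ℂ F := differentiable_deBruijnHDiv_laplace a
  have hFd' : Differentiable ℂ (deriv F) := hFd.deriv
  have hFd'' : Differentiable ℂ (deriv (deriv F)) := hFd'.deriv
  have hFreal : ∀ t : ℝ, (F t).im = 0 := fun t ↦ deBruijnHDiv_ofReal_im _ t
  have hF'real : ∀ t : ℝ, (deriv F t).im = 0 := fun t ↦ im_deriv_ofReal hFd hFreal t
  have hF''real : ∀ t : ℝ, (deriv (deriv F) t).im = 0 := fun t ↦ im_deriv_ofReal hFd' hF'real t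
  obtain ⟨ρ, C, hρ0, hρ, hgr⟩ := UniversalFactor.exists_growth_deBruijnHDiv_laplace a
  -- real coordinates at `x`
  set f0 : ℝ := (F x).re with hf0
  set f1 : ℝ := (deriv F x).re with hf1
  have hF0 : F x = (f0 : ℂ) := Complex.ext (by simp [hf0]) (by simp [hFreal x])
  have hF1 : deriv F x = (f1 : ℂ) := Complex.ext (by simp [hf1]) (by simp [hF'real x])
  have hf0ne : f0 ≠ 0 := fun h => hFx (by rw [hF0, h]; simp)
  -- Step 1: `(F'/F)'(x) ≤ −1/|x−a₀|² < 0` gives `b² f0² < f1²`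
  have key := UniversalFactor.re_deriv_logDeriv_le hFd hρ0 hρ hgr hFreal hzero ha₀ hFx
  have hd : deriv (fun z => deriv F z / F z) x = (((b ^ 2 * f0 ^ 2 - f1 ^ 2) / f0 ^ 2 : ℝ) : ℂ) := by
    have e : deriv (fun z => deriv F z / F z) x =
        (deriv (deriv F) x * F x - deriv F x * deriv F x) / F x ^ 2 :=
      (((hFd.deriv (x : ℂ)).hasDerivAt).div ((hFd (x : ℂ)).hasDerivAt) hFx).deriv
    rw [e, h2, hF1, hF0]
    push_cast
    field_simp
  rw [hd, Complex.ofReal_re] at key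
  have hxa : (x : ℂ) - a₀ ≠ 0 := by
    intro h; rw [sub_eq_zero] at h; rw [h] at hFx; exact hFx ha₀
  have hpos : 0 < 1 / ‖(x : ℂ) - a₀‖ ^ 2 := by positivity
  have hneg : (b ^ 2 * f0 ^ 2 - f1 ^ 2) / f0 ^ 2 < 0 := by linarith
  have hstar : b ^ 2 * f0 ^ 2 < f1 ^ 2 := by
    have hf0sq : 0 < f0 ^ 2 := by positivity
    have := (div_neg_iff.1 hneg)
    rcases this with ⟨h, _⟩ | ⟨_, h⟩
    · linarith
    · linarith
  -- the two Laguerre factors `g = F' + bF`, `h = F' − bF`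
  set G : ℂ → ℂ := fun z ↦ deriv F z + (b : ℂ) * F z with hGdef
  set K : ℂ → ℂ := fun z ↦ deriv F z + ((-b : ℝ) : ℂ) * F z with hKdef
  have hGd : Differentiable ℂ G := hFd'.add (hFd.const_mul _)
  have hKd : Differentiable ℂ K := hFd'.add (hFd.const_mul _)
  have hderivG : ∀ z, deriv G z = deriv (deriv F) z + (b : ℂ) * deriv F z := fun z ↦
    (((hFd' z).hasDerivAt).add (((hFd z).hasDerivAt).const_mul (b : ℂ))).deriv
  have hderivK : ∀ z, deriv K z = deriv (deriv F) z + ((-b : ℝ) : ℂ) * deriv F z := fun z ↦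
    (((hFd' z).hasDerivAt).add (((hFd z).hasDerivAt).const_mul ((-b : ℝ) : ℂ))).deriv
  have hderivG2 : ∀ z, deriv (deriv G) z = deriv (deriv (deriv F)) z + (b : ℂ) * deriv (deriv F) z := by
    intro z
    rw [show deriv G = fun z ↦ deriv (deriv F) z + (b : ℂ) * deriv F z from funext hderivG]
    exact (((hFd'' z).hasDerivAt).add (((hFd' z).hasDerivAt).const_mul (b : ℂ))).deriv
  have hderivK2 : ∀ z, deriv (deriv K) z =
      deriv (deriv (deriv F)) z + ((-b : ℝ) : ℂ) * deriv (deriv F) z := by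
    intro z
    rw [show deriv K = fun z ↦ deriv (deriv F) z + ((-b : ℝ) : ℂ) * deriv F z from funext hderivK]
    exact (((hFd'' z).hasDerivAt).add (((hFd' z).hasDerivAt).const_mul ((-b : ℝ) : ℂ))).deriv
  have hGreal : ∀ t : ℝ, (G t).im = 0 := fun t ↦ by
    simp only [hGdef, Complex.add_im, Complex.mul_im, Complex.ofReal_re, Complex.ofReal_im,
      zero_mul, add_zero, hF'real t, hFreal t, mul_zero]
  have hKreal : ∀ t : ℝ, (K t).im = 0 := fun t ↦ by
    simp only [hKdef, Complex.add_im, Complex.mul_im, Complex.ofReal_re, Complex.ofReal_im,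
      zero_mul, add_zero, hF'real t, hFreal t, mul_zero]
  -- values at `x`
  have hGx : G x = ((f1 + b * f0 : ℝ) : ℂ) := by
    simp only [hGdef, hF0, hF1]; push_cast; ring
  have hKx : K x = ((f1 - b * f0 : ℝ) : ℂ) := by
    simp only [hKdef, hF0, hF1]; push_cast; ring
  have hGx_ne : G x ≠ 0 := by
    rw [hGx]
    intro h
    have h' : f1 + b * f0 = 0 := by exact_mod_cast h
    have : f1 = -(b * f0) := by linarith
    rw [this] at hstar
    nlinarith
  have hKx_ne : K x ≠ 0 := by
    rw [hKx]
    intro h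
    have h' : f1 - b * f0 = 0 := by exact_mod_cast h
    have : f1 = b * f0 := by linarith
    rw [this] at hstar
    nlinarith
  have hG1 : deriv G x = (b : ℂ) * G x := by
    rw [hderivG, h2]; simp only [hGdef]; ring
  have hG2 : deriv (deriv G) x = (b : ℂ) ^ 2 * G x := by
    rw [hderivG2, h3, h2]; simp only [hGdef]; ring
  have hK1 : deriv K x = ((-b : ℝ) : ℂ) * K x := by
    rw [hderivK, h2]; simp only [hKdef]; push_cast; ring
  have hK2 : deriv (deriv K) x = ((-b : ℝ) : ℂ) ^ 2 * K x := by
    rw [hderivK2, h3, h2]; simp only [hKdef]; push_cast; ring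
  -- Laguerre's step: `G`, `K` are real-rooted (not identically zero since nonzero at `x`)
  have hGz : ∀ z, G z = 0 → z.im = 0 := by
    rcases UniversalFactor.laguerre_step hFd hρ0 hρ hgr hFreal hzero b with h0 | h
    · exact absurd (h0 x) hGx_ne
    · exact h
  have hKz : ∀ z, K z = 0 → z.im = 0 := by
    rcases UniversalFactor.laguerre_step hFd hρ0 hρ hgr hFreal hzero (-b) with h0 | h
    · exact absurd (h0 x) hKx_ne
    · exact h
  obtain ⟨ρ₁, C₁, hρ₁0, hρ₁, hgrG⟩ := UniversalFactor.exists_growth_deriv_add_mul hFd hρ0 hρ hgr (b : ℂ)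
  obtain ⟨ρ₂, C₂, hρ₂0, hρ₂, hgrK⟩ :=
    UniversalFactor.exists_growth_deriv_add_mul hFd hρ0 hρ hgr ((-b : ℝ) : ℂ)
  -- Step 3: if `G` (or `K`) has a zero, Lemma A applies at `x`
  by_cases hGzero : ∃ a₁, G a₁ = 0
  · obtain ⟨a₁, ha₁⟩ := hGzero
    exact false_of_logDeriv_critical hGd hρ₁0 hρ₁ hgrG hGreal hGz ha₁ hGx_ne (b : ℂ) hG1 hG2
  by_cases hKzero : ∃ a₂, K a₂ = 0
  · obtain ⟨a₂, ha₂⟩ := hKzero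
    exact false_of_logDeriv_critical hKd hρ₂0 hρ₂ hgrK hKreal hKz ha₂ hKx_ne ((-b : ℝ) : ℂ) hK1 hK2
  push Not at hGzero hKzero
  -- Step 4: both zero-free ⇒ `G' = bG`, `K' = −bK` everywhere ⇒ `F'' = b²F` everywhere
  have hGode : ∀ z, deriv G z = (b : ℂ) * G z := fun z ↦ by
    have h := logDeriv_eq_of_forall_ne_zero hGd hρ₁0 hρ₁ hgrG hGreal hGzero z x
    rw [hG1, mul_div_assoc, div_self hGx_ne, mul_one] at h
    rwa [div_eq_iff (hGzero z)] at h
  have hKode : ∀ z, deriv K z = ((-b : ℝ) : ℂ) * K z := fun z ↦ by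
    have h := logDeriv_eq_of_forall_ne_zero hKd hρ₂0 hρ₂ hgrK hKreal hKzero z x
    rw [hK1, mul_div_assoc, div_self hKx_ne, mul_one] at h
    rwa [div_eq_iff (hKzero z)] at h
  have hFode : ∀ z, deriv (deriv F) z = (b : ℂ) ^ 2 * F z := fun z ↦ by
    have h1 := hGode z
    have h2' := hKode z
    rw [hderivG] at h1
    rw [hderivK] at h2'
    simp only [hGdef, hKdef] at h1 h2'
    push_cast at h1 h2' ⊢
    linear_combination (h1 + h2') / 2
  -- Step 5: `W = F'² − b²F²` is constant; `W(0) = −b²F(0)² ≤ 0 < W(x)`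
  set W : ℂ → ℂ := fun z ↦ deriv F z * deriv F z - (b : ℂ) ^ 2 * (F z * F z) with hWdef
  have hWd : Differentiable ℂ W := (hFd'.mul hFd').sub ((hFd.mul hFd).const_mul _)
  have hW' : ∀ z, deriv W z = 0 := fun z ↦ by
    have h := (((hFd' z).hasDerivAt).mul ((hFd' z).hasDerivAt)).sub
      ((((hFd z).hasDerivAt).mul ((hFd z).hasDerivAt)).const_mul ((b : ℂ) ^ 2))
    have e : deriv W z = deriv (deriv F) z * deriv F z + deriv F z * deriv (deriv F) z
        - (b : ℂ) ^ 2 * (deriv F z * F z + F z * deriv F z) := h.deriv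
    rw [e, hFode z]
    ring
  have hWconst := is_const_of_deriv_eq_zero hWd hW' 0 (x : ℂ)
  -- `F'(0) = 0` by evenness
  have heven : (fun z ↦ F (-z)) = F := funext fun z ↦ deBruijnHDiv_neg _ z
  have hF'0 : deriv F 0 = 0 := by
    have h : deriv F 0 = deriv (fun z ↦ F (-z)) 0 := by rw [heven]
    rw [deriv_comp_neg, neg_zero] at h
    linear_combination h / 2
  have hF0real : (F 0).im = 0 := by simpa using hFreal 0
  set w0 : ℝ := (F 0).re with hw0
  have hF00 : F 0 = (w0 : ℂ) := Complex.ext (by simp [hw0]) (by simp [hF0real])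
  have hW0 : W 0 = ((-(b ^ 2 * w0 ^ 2) : ℝ) : ℂ) := by
    simp only [hWdef, hF'0, hF00]; push_cast; ring
  have hWx : W x = ((f1 ^ 2 - b ^ 2 * f0 ^ 2 : ℝ) : ℂ) := by
    simp only [hWdef, hF0, hF1]; push_cast; ring
  rw [hW0, hWx] at hWconst
  have hreal_eq : -(b ^ 2 * w0 ^ 2) = f1 ^ 2 - b ^ 2 * f0 ^ 2 := by exact_mod_cast hWconst
  nlinarith [sq_nonneg (b * w0)]


/-- `F_a` has a zero as soon as `H_0` is not constant on the real axis (no `X(a)` needed):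
a zero-free `F_a` has constant logarithmic derivative, `= F_a'(0)/F_a(0) = 0` by evenness, so
`F_a` is constant and `H_0 = F_a − F_a''/a² = F_a` is constant. -/
theorem exists_zero_of_deBruijnH_ne {a u v : ℝ} (hne : deBruijnH 0 u ≠ deBruijnH 0 v) :
    ∃ z₀, deBruijnHDiv (fun u : ℝ => 1 + u ^ 2 / a ^ 2) z₀ = 0 := by
  by_contra h
  push Not at h
  set F : ℂ → ℂ := deBruijnHDiv fun u : ℝ => 1 + u ^ 2 / a ^ 2 with hFdef
  have hFd : Differentiable ℂ F := differentiable_deBruijnHDiv_laplace a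
  have hFreal : ∀ t : ℝ, (F t).im = 0 := fun t ↦ deBruijnHDiv_ofReal_im _ t
  obtain ⟨ρ, C, hρ0, hρ, hgr⟩ := UniversalFactor.exists_growth_deBruijnHDiv_laplace a
  have heven : (fun z ↦ F (-z)) = F := funext fun z ↦ deBruijnHDiv_neg _ z
  have hF'0 : deriv F 0 = 0 := by
    have h0 : deriv F 0 = deriv (fun z ↦ F (-z)) 0 := by rw [heven]
    rw [deriv_comp_neg, neg_zero] at h0
    linear_combination h0 / 2
  have hF' : ∀ z, deriv F z = 0 := fun z ↦ by
    have hl := logDeriv_eq_of_forall_ne_zero hFd hρ0 hρ hgr hFreal h z 0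
    rw [hF'0, zero_div, div_eq_zero_iff] at hl
    exact hl.resolve_right (h z)
  have hF'' : ∀ z, deriv (deriv F) z = 0 := fun z ↦ by
    rw [show deriv F = fun _ ↦ (0 : ℂ) from funext hF']
    simp
  have hconst := is_const_of_deriv_eq_zero hFd hF' (u : ℂ) (v : ℂ)
  have hH : ∀ z, deBruijnH 0 z = F z := fun z ↦ by
    have h1 := deBruijnHDiv_laplace_sub_deriv_deriv a z
    rw [← hFdef] at h1
    rw [← h1, hF'' z, zero_div, sub_zero]
  exact hne (by rw [hH, hH, hconst])

/-- **`ZeroFreeBracket` (card pencil-bracket-count, lemma K1), contour-free.** Let `a > 0`,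
`c < m < d`, `σ = ±1`. If `σ·F_a > 0` on `[c,d]`, `σ·H_0(c) > 0`, `σ·H_0(d) > 0` and `σ·H_0(m) ≤ 0`
(a critical zero of `ξ` swallowed by the Laplace smoothing), then `F_a` has a non-real zero.
Proof: on `[0,1] × [c,d]` take a point `(s*, x*)` of the closed set `{(1−s)σF_a + sσH_0 ≤ 0}` with
least `s`; then `s* > 0`, `x* ∈ (c,d)` is an interior zero AND minimum of
`G = (1−s*)F_a + s*H_0 = F_a − (s*/a²)F_a″`, so `G(x*) = G′(x*) = 0` with `F_a(x*) ≠ 0`,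
which `touching_false` forbids under `X(a)`. -/
theorem zeroFreeBracket {a c d m σ : ℝ} (ha : 0 < a) (hcm : c < m) (hmd : m < d)
    (hσ : σ = 1 ∨ σ = -1)
    (hF : ∀ x ∈ Icc c d, 0 < σ * (deBruijnHDiv (fun u : ℝ => 1 + u ^ 2 / a ^ 2) x).re)
    (hc : 0 < σ * (deBruijnH 0 c).re) (hd : 0 < σ * (deBruijnH 0 d).re)
    (hm : σ * (deBruijnH 0 m).re ≤ 0) :
    ¬ HasOnlyRealZeros (deBruijnHDiv fun u : ℝ => 1 + u ^ 2 / a ^ 2) := by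
  intro hX
  set F : ℂ → ℂ := deBruijnHDiv fun u : ℝ => 1 + u ^ 2 / a ^ 2 with hFdef
  have hFd : Differentiable ℂ F := differentiable_deBruijnHDiv_laplace a
  have hFd' : Differentiable ℂ (deriv F) := hFd.deriv
  have hFd'' : Differentiable ℂ (deriv (deriv F)) := hFd'.deriv
  have hHd : Differentiable ℂ (deBruijnH 0) := differentiable_deBruijnH_holds 0
  have hFreal : ∀ t : ℝ, (F t).im = 0 := fun t ↦ deBruijnHDiv_ofReal_im _ t
  have hHreal : ∀ t : ℝ, (deBruijnH 0 t).im = 0 := UniversalFactor.deBruijnH_zero_ofReal_im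
  have hσ0 : σ ≠ 0 := by rcases hσ with h | h <;> rw [h] <;> norm_num
  -- the pencil on the real axis
  set φ : ℝ × ℝ → ℝ := fun p ↦ σ * ((1 - p.1) * (F p.2).re + p.1 * (deBruijnH 0 p.2).re) with hφ
  have hFre : Continuous fun x : ℝ ↦ (F x).re :=
    Complex.continuous_re.comp (hFd.continuous.comp Complex.continuous_ofReal)
  have hHre : Continuous fun x : ℝ ↦ (deBruijnH 0 x).re :=
    Complex.continuous_re.comp (hHd.continuous.comp Complex.continuous_ofReal)
  have hφc : Continuous φ := by
    have h1 : Continuous fun p : ℝ × ℝ ↦ (F p.2).re := hFre.comp continuous_snd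
    have h2 : Continuous fun p : ℝ × ℝ ↦ (deBruijnH 0 p.2).re := hHre.comp continuous_snd
    exact continuous_const.mul (((continuous_const.sub continuous_fst).mul h1).add
      (continuous_fst.mul h2))
  -- the closed set where the pencil is `≤ 0`, and a point of it with least parameter
  set Z : Set (ℝ × ℝ) := (Icc (0:ℝ) 1 ×ˢ Icc c d) ∩ {p | φ p ≤ 0} with hZ
  have hZc : IsCompact Z :=
    (isCompact_Icc.prod isCompact_Icc).inter_right (isClosed_le hφc continuous_const)
  have hmZ : ((1:ℝ), m) ∈ Z := by
    refine ⟨⟨⟨zero_le_one, le_rfl⟩, ⟨hcm.le, hmd.le⟩⟩, ?_⟩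
    show σ * ((1 - 1) * (F m).re + 1 * (deBruijnH 0 m).re) ≤ 0
    simpa using hm
  obtain ⟨p, hpZ, hpmin⟩ := hZc.exists_isMinOn ⟨_, hmZ⟩ continuous_fst.continuousOn
  obtain ⟨⟨⟨hs0, hs1⟩, ⟨hxc, hxd⟩⟩, hple⟩ := hpZ
  set s := p.1 with hs
  set x := p.2 with hx
  have hple' : φ (s, x) ≤ 0 := hple
  -- (b) below `s` the pencil is positive on `[c,d]`
  have hbelow : ∀ s' ∈ Icc (0:ℝ) 1, s' < s → ∀ y ∈ Icc c d, 0 < φ (s', y) := by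
    intro s' hs' hlt y hy
    by_contra hneg
    push Not at hneg
    have hmem : (s', y) ∈ Z := ⟨⟨hs', hy⟩, hneg⟩
    have h1 : s ≤ s' := hpmin hmem
    linarith
  -- (a) `s > 0`
  have hs_pos : 0 < s := by
    rcases eq_or_lt_of_le hs0 with h0 | h0
    · exfalso
      have h1 : φ (s, x) = σ * (F x).re := by
        simp only [hφ, ← h0]
        ring
      have h2 := hF x ⟨hxc, hxd⟩
      linarith
    · exact h0
  -- affine structure in `s`
  have haff : ∀ (s₁ s₂ : ℝ) (y : ℝ),
      φ (s₂, y) = φ (s₁, y) + (s₂ - s₁) * (σ * ((deBruijnH 0 y).re - (F y).re)) := by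
    intro s₁ s₂ y
    simp only [hφ]
    ring
  -- (e) at `s` the pencil is `≥ 0` on `[c,d]` (so `= 0` at `x`)
  have hnonneg : ∀ y ∈ Icc c d, 0 ≤ φ (s, y) := by
    intro y hy
    by_contra hneg
    push Not at hneg
    set B := σ * ((deBruijnH 0 y).re - (F y).re) with hB
    obtain ⟨ε, hε, hεs, hεB⟩ : ∃ ε : ℝ, 0 < ε ∧ ε ≤ s ∧ ε * |B| < -φ (s, y) := by
      refine ⟨min s (-φ (s, y) / (2 * (|B| + 1))), ?_, min_le_left _ _, ?_⟩
      · exact lt_min hs_pos (div_pos (by linarith) (by positivity))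
      · have h1 : min s (-φ (s, y) / (2 * (|B| + 1))) * |B| ≤
            -φ (s, y) / (2 * (|B| + 1)) * |B| :=
          mul_le_mul_of_nonneg_right (min_le_right _ _) (abs_nonneg B)
        have h2 : -φ (s, y) / (2 * (|B| + 1)) * |B| < -φ (s, y) := by
          rw [div_mul_eq_mul_div, div_lt_iff₀ (by positivity)]
          nlinarith [abs_nonneg B]
        linarith
    have hs' : s - ε ∈ Icc (0:ℝ) 1 := ⟨by linarith, by linarith⟩
    have hpos := hbelow (s - ε) hs' (by linarith) y hy
    rw [haff s (s - ε) y] at hpos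
    have hb' : (s - ε - s) * B ≤ ε * |B| := by
      have : (s - ε - s) * B = -(ε * B) := by ring
      rw [this]
      nlinarith [neg_abs_le B, le_abs_self B, hε.le]
    linarith
  have hzero : φ (s, x) = 0 := le_antisymm hple' (hnonneg x ⟨hxc, hxd⟩)
  -- (d) `x` is interior
  have hends : ∀ y : ℝ, 0 < σ * (deBruijnH 0 y).re → y ∈ Icc c d → 0 < φ (s, y) := by
    intro y hy hyI
    have h1 := hF y hyI
    have : φ (s, y) = (1 - s) * (σ * (F y).re) + s * (σ * (deBruijnH 0 y).re) := by
      simp only [hφ]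
      ring
    rw [this]
    nlinarith
  have hxc' : c < x := by
    rcases eq_or_lt_of_le hxc with h | h
    · exfalso
      have h1 := hends c hc ⟨le_rfl, by linarith⟩
      rw [h] at h1
      linarith
    · exact h
  have hxd' : x < d := by
    rcases eq_or_lt_of_le hxd with h | h
    · exfalso
      have h1 := hends d hd ⟨by linarith, le_rfl⟩
      rw [← h] at h1
      linarith
    · exact h
  -- the complex pencil `Gc = (1 − s)F + sH_0`
  set Gc : ℂ → ℂ := fun z ↦ (1 - (s : ℂ)) * F z + (s : ℂ) * deBruijnH 0 z with hGc
  have hGcd : Differentiable ℂ Gc := (hFd.const_mul _).add (hHd.const_mul _)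
  have hGcre : ∀ y : ℝ, φ (s, y) = σ * (Gc y).re := by
    intro y
    simp only [hφ, hGc, Complex.add_re, Complex.mul_re, Complex.sub_re, Complex.one_re,
      Complex.ofReal_re, Complex.sub_im, Complex.one_im, Complex.ofReal_im, hFreal y, hHreal y]
    ring
  have hGcim : ∀ y : ℝ, (Gc y).im = 0 := by
    intro y
    simp only [hGc, Complex.add_im, Complex.mul_im, Complex.sub_re, Complex.one_re,
      Complex.ofReal_re, Complex.sub_im, Complex.one_im, Complex.ofReal_im, hFreal y, hHreal y]
    ring
  -- `Gc(x) = 0`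
  have hGx0 : Gc x = 0 := by
    apply Complex.ext
    · have h1 := hGcre x
      rw [hzero] at h1
      have h2 : σ * (Gc x).re = 0 := h1.symm
      simpa [hσ0] using h2
    · simpa using hGcim x
  -- `Gc'(x) = 0` from the interior minimum of `φ(s, ·)`
  have hderivre : HasDerivAt (fun y : ℝ ↦ φ (s, y)) (σ * (deriv Gc x).re) x := by
    have h1 : HasDerivAt (fun y : ℝ ↦ (Gc y).re) (deriv Gc x).re x :=
      ((hGcd x).hasDerivAt).real_of_complex
    have h2 := h1.const_mul σ
    refine h2.congr_of_eventuallyEq (Filter.Eventually.of_forall fun y ↦ ?_)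
    exact hGcre y
  have hlocmin : IsLocalMin (fun y : ℝ ↦ φ (s, y)) x := by
    refine Filter.eventually_of_mem (Icc_mem_nhds hxc' hxd') fun y hy ↦ ?_
    show φ (s, x) ≤ φ (s, y)
    rw [hzero]
    exact hnonneg y hy
  have hGx1 : deriv Gc x = 0 := by
    have h1 : σ * (deriv Gc x).re = 0 := hlocmin.hasDerivAt_eq_zero hderivre
    apply Complex.ext
    · simpa [hσ0] using h1
    · simpa using im_deriv_ofReal hGcd hGcim x
  -- translate to `F″ = b²F`, `F‴ = b²F′` at `x`, with `b² = a²/s`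
  have hODE : ∀ z, F z - deriv (deriv F) z / (a : ℂ) ^ 2 = deBruijnH 0 z := fun z ↦ by
    have h1 := deBruijnHDiv_laplace_sub_deriv_deriv a z
    rwa [← hFdef] at h1
  have hHfun : deBruijnH 0 = fun z ↦ F z - deriv (deriv F) z / (a : ℂ) ^ 2 :=
    funext fun z ↦ (hODE z).symm
  have hHderiv : ∀ z, deriv (deBruijnH 0) z = deriv F z - deriv (deriv (deriv F)) z / (a : ℂ) ^ 2 := by
    intro z
    rw [hHfun]
    exact (((hFd z).hasDerivAt).sub (((hFd'' z).hasDerivAt).div_const _)).deriv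
  have hGcderiv : deriv Gc x = (1 - (s : ℂ)) * deriv F x + (s : ℂ) * deriv (deBruijnH 0) x :=
    ((((hFd x).hasDerivAt).const_mul _).add (((hHd x).hasDerivAt).const_mul _)).deriv
  have ha2 : (a : ℂ) ^ 2 ≠ 0 := pow_ne_zero 2 (by exact_mod_cast ha.ne')
  have hsC : (s : ℂ) ≠ 0 := by exact_mod_cast hs_pos.ne'
  have ha' : (a : ℂ) ≠ 0 := by exact_mod_cast ha.ne'
  set b : ℝ := Real.sqrt (a ^ 2 / s) with hb
  have hb2 : (b : ℂ) ^ 2 = (a : ℂ) ^ 2 / (s : ℂ) := by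
    have : b ^ 2 = a ^ 2 / s := by rw [hb, Real.sq_sqrt (by positivity)]
    exact_mod_cast this
  have h2 : deriv (deriv F) x = (b : ℂ) ^ 2 * F x := by
    have h1 := hGx0
    simp only [hGc] at h1
    rw [← hODE x] at h1
    have key : F x = (s : ℂ) * (deriv (deriv F) x / (a : ℂ) ^ 2) := by linear_combination h1
    rw [hb2, div_mul_eq_mul_div, eq_div_iff hsC, key]
    field_simp
  have h3 : deriv (deriv (deriv F)) x = (b : ℂ) ^ 2 * deriv F x := by
    have h1 := hGx1
    rw [hGcderiv, hHderiv] at h1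
    have key : deriv F x = (s : ℂ) * (deriv (deriv (deriv F)) x / (a : ℂ) ^ 2) := by
      linear_combination h1
    rw [hb2, div_mul_eq_mul_div, eq_div_iff hsC, key]
    field_simp
  have hFx : F x ≠ 0 := by
    intro h0
    have h1 := hF x ⟨hxc, hxd⟩
    rw [h0] at h1
    simp at h1
  have hz : ∃ z₀, F z₀ = 0 := by
    refine exists_zero_of_deBruijnH_ne (u := c) (v := m) fun heq ↦ ?_
    have : σ * (deBruijnH 0 c).re = σ * (deBruijnH 0 m).re := by rw [heq]
    linarith
  exact touching_false hX hz hFx h2 h3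


/-- `ZeroFreeBracket`, positive bracket (`σ = 1`). -/
theorem zeroFreeBracket_pos {a c d m : ℝ} (ha : 0 < a) (hcm : c < m) (hmd : m < d)
    (hF : ∀ x ∈ Icc c d, 0 < (deBruijnHDiv (fun u : ℝ => 1 + u ^ 2 / a ^ 2) x).re)
    (hc : 0 < (deBruijnH 0 c).re) (hd : 0 < (deBruijnH 0 d).re) (hm : (deBruijnH 0 m).re ≤ 0) :
    ¬ HasOnlyRealZeros (deBruijnHDiv fun u : ℝ => 1 + u ^ 2 / a ^ 2) :=
  zeroFreeBracket (σ := 1) ha hcm hmd (Or.inl rfl) (fun x hx ↦ by simpa using hF x hx)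
    (by simpa using hc) (by simpa using hd) (by simpa using hm)

/-- `ZeroFreeBracket`, negative bracket (`σ = −1`). -/
theorem zeroFreeBracket_neg {a c d m : ℝ} (ha : 0 < a) (hcm : c < m) (hmd : m < d)
    (hF : ∀ x ∈ Icc c d, (deBruijnHDiv (fun u : ℝ => 1 + u ^ 2 / a ^ 2) x).re < 0)
    (hc : (deBruijnH 0 c).re < 0) (hd : (deBruijnH 0 d).re < 0) (hm : 0 ≤ (deBruijnH 0 m).re) :
    ¬ HasOnlyRealZeros (deBruijnHDiv fun u : ℝ => 1 + u ^ 2 / a ^ 2) :=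
  zeroFreeBracket (σ := -1) ha hcm hmd (Or.inr rfl) (fun x hx ↦ by simpa using hF x hx)
    (by simpa using hc) (by simpa using hd) (by simpa using hm)

/-- **`MediumKernelNoGo` from brackets** (the crux by name, in the route's inlined notation): if for
every `a ∈ [π/8, 32]` there is a same-sign bracket `c < m < d` — `F_a` of strict sign `σ` on `[c,d]`,
`σH_0(c) > 0`, `σH_0(d) > 0`, `σH_0(m) ≤ 0` — then every `F_a` of the medium window has a non-real
zero. This is the assembly of card pencil-bracket-count: its K2 (a finite certified cover of
`[π/8,32]` by `a`-boxes carrying such brackets) is exactly the hypothesis. -/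
theorem mediumKernelNoGo_of_brackets
    (h : ∀ a : ℝ, Real.pi / 8 ≤ a → a ≤ 32 → ∃ c m d σ : ℝ, c < m ∧ m < d ∧ (σ = 1 ∨ σ = -1) ∧
      (∀ x ∈ Icc c d, 0 < σ * (deBruijnHDiv (fun u : ℝ => 1 + u ^ 2 / a ^ 2) x).re) ∧
      0 < σ * (deBruijnH 0 c).re ∧ 0 < σ * (deBruijnH 0 d).re ∧ σ * (deBruijnH 0 m).re ≤ 0) :
    UniversalFactor.MediumKernelNoGo := by
  intro a ha h32
  have ha0 : 0 < a := lt_of_lt_of_le (by positivity) ha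
  obtain ⟨c, m, d, σ, hcm, hmd, hσ, hF, hc, hd, hm⟩ := h a ha h32
  exact zeroFreeBracket ha0 hcm hmd hσ hF hc hd hm

end TriageTouching
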